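import Mathlib
import Literature.NumberTheory.LFunctions.Zhang2022.Section15ResidueLimits
import Literature.NumberTheory.LFunctions.Zhang2022.Section15ResidueNonvanishing
import Literature.NumberTheory.LFunctions.Zhang2022.Section16ResidueEstimates
import HarnessLib

/-!
# Zhang (2022) §15 p. 88: the residues `ℛ₁ⱼ` in RELATIVE form, `ℛ₁ⱼ = M₁ⱼ(1 + O(𝓛⁻⁶))` (Z22:§15.u059, surviving form)

Topic `Literature/NumberTheory/LFunctions/Zhang2022` (Landau–Siegel audit tree; verdict-neutral).
Y. Zhang, *Discrete mean estimates and the Landau–Siegel zero*, arXiv:2211.02515v1 (2022)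
[Zhang2022LandauSiegel] — **an unrefereed manuscript under adjudication** (cell siegel-zhang, D-0069
width campaign). DISCHARGE file (theorems only; no new definitions, no new facts); no statement about
Theorems 1–2 of the manuscript or about Landau–Siegel zeros is made or implied.

DAG node `Z22:§15.u059` [Z22 p.88, tex L4380–L4382]: "`ℛ₁ⱼ = P₄^{β₃−βⱼ}/((β_{j+1}−βⱼ)(β_{j+2}−βⱼ)L′(1,χ))
+ O(1/𝓛³)`". AS PRINTED the absolute `O(𝓛⁻³)` is a relative `O(𝓛⁻²¹|L′|)` claim (the main term `M₁ⱼ`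
has size `≍ α⁻²/|L′| = 𝓛¹⁸/(π²|L′(1,χ)|)`), not derivable from Lemma 5.8 (GAP-LEDGER row G-d53-1,
class printed-false-pointwise, harmless). This file PROVES the surviving RELATIVE form for the concrete
typed residues `Typed.Section15B.calR1 c′ χ j` (the `limUnder` of (15.16)), unconditionally under (A):
`calR1_one_rel`, `calR1_two_rel`, `calR1_three_rel`: for all large `D`,
`|ℛ₁ⱼ − M₁ⱼ| ≤ C𝓛⁻⁶·|M₁ⱼ|`, from the closed forms `calR1_*_eq` (`Section15ResidueLimits`):
`ℛ₁₁ = M₁₁·Z_u·Z₁⁻¹·Λ₁⁻¹·ω₁(β₃−β₁)` (`u = β₂−β₁`, `Z_u = uζ(1+u)`, `Z₁ = (−β₁)ζ(1−β₁)`,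
`Λ₁ = L(1−β₁,χ)/(−β₁L′)`), and similarly for `j = 2, 3` (two `Z_u` factors for `j = 3`), each factor
`1 + O(𝓛⁻⁶)` by `zeta_shift_bounds` (Mathlib `riemannZeta₁`) and `L_one_sub_beta_bounds` (tree Lemma 5.8).
`residue_setup` packages the thresholds once.
-/

noncomputable section

open Complex Real Filter Topology

namespace Literature.NumberTheory.LFunctions.Zhang2022.ResidueValues

open Skeleton Typed.Section15B

variable (c' : ℝ)

/-! ## The common setup: all the eventual facts at once -/

/-- **The eventual regime** (under (A), `D ≥ D₀(c′)`): `𝓛 ≥ 3`, `|c′α𝓛| ≤ 1/14`, `16Kπ + 1 ≤ 𝓛`, `χ ≠ 1`,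
`|L′(1,χ)| ≥ c` (Lemma 5.7), the `ζ`-factor bounds for `0 < |u| ≤ 8α`, and the `L`-factor bounds for
`α/2 ≤ |β| ≤ 4α` (Lemma 5.8). [cite: Zhang2022LandauSiegel, §15 p. 88] -/
theorem residue_setup : ∃ K : ℝ, 0 ≤ K ∧ ∃ CL : ℝ, 0 ≤ CL ∧ ∃ c : ℝ, 0 < c ∧
    ForAllLarge fun D _ χ => AssumptionA D χ →
      (3 ≤ ell D ∧ |c' * alpha D * ell D| ≤ 1 / 14 ∧ 16 * K * π + 1 ≤ ell D ∧ χ ≠ 1) ∧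
      c ≤ ‖deriv χ.LFunction 1‖ ∧
      (∀ u : ℂ, u ≠ 0 → ‖u‖ ≤ 8 * alpha D → riemannZeta (1 + u) ≠ 0 ∧
        ‖u * riemannZeta (1 + u) - 1‖ ≤ K * ‖u‖ ∧ ‖u * riemannZeta (1 + u) - 1‖ ≤ 1 / 2) ∧
      (∀ β : ℂ, alpha D / 2 ≤ ‖β‖ → ‖β‖ ≤ 4 * alpha D → χ.LFunction (1 - β) ≠ 0 ∧
        ‖χ.LFunction (1 - β) / (-β * deriv χ.LFunction 1) - 1‖ ≤ CL / ell D ^ 6 ∧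
          CL / ell D ^ 6 ≤ 1 / 2) := by
  obtain ⟨c, hc, h57⟩ := norm_deriv_LFunction_one_ge
  obtain ⟨r, hr, K, hK, hζ⟩ := zeta_shift_bounds
  obtain ⟨CL, hCL0, hLb⟩ := L_one_sub_beta_bounds
  obtain ⟨D₀, hall⟩ := h57.and hLb
  refine ⟨K, hK, CL, hCL0, c, hc,
    max D₀ (max (max ⌈Real.exp 3⌉₊ ⌈Real.exp (14 * |c'| * π)⌉₊)
      (max ⌈Real.exp (8 * π / r + 1)⌉₊ ⌈Real.exp (16 * K * π + 1)⌉₊)), fun D _ χ hD hq hp hA => ?_⟩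
  have hD₀ : D₀ ≤ D := le_trans (le_max_left _ _) hD
  have hD1 := le_trans (le_trans (le_max_left _ _) (le_max_right _ _)) hD
  have hD2 := le_trans (le_trans (le_max_left _ _) (le_trans (le_max_right _ _) (le_max_right _ _))) hD
  have hD3 := le_trans (le_trans (le_max_right _ _) (le_trans (le_max_right _ _) (le_max_right _ _))) hD
  obtain ⟨hL, he⟩ := thresholds c' hD1
  have hℓ : 0 < ell D := by linarith
  have hlogD2 : 8 * π / r + 1 ≤ ell D := by
    have h : Real.exp (8 * π / r + 1) ≤ D := le_trans (Nat.le_ceil _) (by exact_mod_cast hD2)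
    exact (Real.le_log_iff_exp_le (lt_of_lt_of_le (Real.exp_pos _) h)).mpr h
  have hlogD3 : 16 * K * π + 1 ≤ ell D := by
    have h : Real.exp (16 * K * π + 1) ≤ D := le_trans (Nat.le_ceil _) (by exact_mod_cast hD3)
    exact (Real.le_log_iff_exp_le (lt_of_lt_of_le (Real.exp_pos _) h)).mpr h
  have h8α : 8 * alpha D < r := by
    have h1 : alpha D ≤ π / ell D := alpha_le hL
    have h2 : 8 * π / r < ell D := by linarith
    calc 8 * alpha D ≤ 8 * (π / ell D) := by linarith
      _ = (8 * π / r) * (r / ell D) := by field_simp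
      _ < ell D * (r / ell D) := by gcongr
      _ = r := by field_simp
  have hχ1 : χ ≠ 1 := by
    have hD1' : D ≠ 1 := by
      rintro rfl; norm_num [ell] at hL
    exact GammaFactor.ne_one_of_isPrimitive hp hD1'
  obtain ⟨g57, gL⟩ := hall D χ hD₀ hq hp
  refine ⟨⟨hL, he, hlogD3, hχ1⟩, g57 hA, fun u hu0 hu => hζ u hu0 (lt_of_le_of_lt hu h8α), gL hA⟩

/-- **The `ζ`-factors**: in the regime of `residue_setup`, for `0 < |u| ≤ 8α`: `ζ(1+u) ≠ 0`,
`|uζ(1+u) − 1| ≤ 16Kπ𝓛⁻⁹`, `|(uζ(1+u))⁻¹ − 1| ≤ 16Kπ𝓛⁻⁹`, and `16Kπ𝓛⁻⁹ ≤ 1`.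
[cite: Zhang2022LandauSiegel, §15 p. 88] -/
theorem zetaFactor_bounds {D : ℕ} (hL : 3 ≤ ell D) {K : ℝ} (hK : 0 ≤ K) (hKℓ : 16 * K * π + 1 ≤ ell D)
    (hζ : ∀ u : ℂ, u ≠ 0 → ‖u‖ ≤ 8 * alpha D → riemannZeta (1 + u) ≠ 0 ∧
      ‖u * riemannZeta (1 + u) - 1‖ ≤ K * ‖u‖ ∧ ‖u * riemannZeta (1 + u) - 1‖ ≤ 1 / 2)
    {u : ℂ} (hu0 : u ≠ 0) (hu : ‖u‖ ≤ 8 * alpha D) :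
    riemannZeta (1 + u) ≠ 0 ∧ ‖u * riemannZeta (1 + u) - 1‖ ≤ 16 * K * π / ell D ^ 9 ∧
      ‖(u * riemannZeta (1 + u))⁻¹ - 1‖ ≤ 16 * K * π / ell D ^ 9 ∧ 16 * K * π / ell D ^ 9 ≤ 1 := by
  have hℓ : 0 < ell D := by linarith
  have hℓ1 : 1 ≤ ell D := by linarith
  have hαeq := Section2.alpha_eq_pi_div_ell9 D
  obtain ⟨hne, h1, h2⟩ := hζ u hu0 hu
  have hKu : K * ‖u‖ ≤ 8 * K * π / ell D ^ 9 := by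
    calc K * ‖u‖ ≤ K * (8 * alpha D) := by gcongr
      _ = 8 * K * π / ell D ^ 9 := by rw [hαeq]; ring
  have h16 : 8 * K * π / ell D ^ 9 ≤ 16 * K * π / ell D ^ 9 := by
    gcongr; nlinarith [mul_nonneg hK Real.pi_pos.le]
  have hmin : ‖u * riemannZeta (1 + u) - 1‖ ≤ min (K * ‖u‖) (1 / 2) := le_min h1 h2
  have hinv := norm_inv_sub_one_le hmin (min_le_right _ _)
  refine ⟨hne, h1.trans (hKu.trans h16), hinv.trans ?_, ?_⟩
  · calc 2 * min (K * ‖u‖) (1 / 2) ≤ 2 * (K * ‖u‖) := by gcongr; exact min_le_left _ _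
      _ ≤ 2 * (8 * K * π / ell D ^ 9) := by gcongr
      _ = 16 * K * π / ell D ^ 9 := by ring
  · rw [div_le_one (pow_pos hℓ 9)]
    calc 16 * K * π ≤ ell D := by linarith
      _ = ell D ^ 1 := (pow_one _).symm
      _ ≤ ell D ^ 9 := pow_le_pow_right₀ hℓ1 (by norm_num)

/-! ## The algebra: `ℛ₁ⱼ` as its main term times near-one factors -/

/-- `j = 1, 2`: `ζu/(z₁l)·(Pw/d) − P/(u d L) = (P/(u d L))·((uζu)((−b)z₁)⁻¹(l/((−b)L))⁻¹w − 1)`.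
[cite: Zhang2022LandauSiegel, §15 p. 88] -/
theorem residue_identity15 {u d L z₁ l ζu P w b : ℂ} (hu : u ≠ 0) (hd : d ≠ 0) (hL : L ≠ 0)
    (hz : z₁ ≠ 0) (hl : l ≠ 0) (hb : b ≠ 0) :
    ζu / (z₁ * l) * (P * w / d) - P / (u * d * L) =
      P / (u * d * L) * (u * ζu * (-b * z₁)⁻¹ * (l / (-b * L))⁻¹ * w - 1) := by
  field_simp

/-- `j = 3`: `ζ₁ζ₂/(z₃l)·(Pw) − P/(u₁u₂L) = (P/(u₁u₂L))·((u₁ζ₁)(u₂ζ₂)((−b)z₃)⁻¹(l/((−b)L))⁻¹w − 1)`.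
[cite: Zhang2022LandauSiegel, §15 p. 88] -/
theorem residue_identity15_three {u₁ u₂ L z₃ l ζ₁ ζ₂ P w b : ℂ} (hu₁ : u₁ ≠ 0) (hu₂ : u₂ ≠ 0)
    (hL : L ≠ 0) (hz : z₃ ≠ 0) (hl : l ≠ 0) (hb : b ≠ 0) :
    ζ₁ * ζ₂ / (z₃ * l) * (P * w) - P / (u₁ * u₂ * L) =
      P / (u₁ * u₂ * L) * (u₁ * ζ₁ * (u₂ * ζ₂) * (-b * z₃)⁻¹ * (l / (-b * L))⁻¹ * w - 1) := by
  field_simp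

/-- `|M·(x − 1)| ≤ t·|M|` from `|x − 1| ≤ t`. [cite: Zhang2022LandauSiegel, §15 p. 88] -/
theorem norm_mul_sub_one_le_rel {M x : ℂ} {t : ℝ} (h : ‖x - 1‖ ≤ t) : ‖M * (x - 1)‖ ≤ t * ‖M‖ := by
  rw [norm_mul, mul_comm]; exact mul_le_mul_of_nonneg_right h (norm_nonneg _)

/-! ## `ℛ₁₁`, `ℛ₁₂`, `ℛ₁₃` in relative form -/

/-- **`ℛ₁₁ = M₁₁(1 + O(𝓛⁻⁶))`**, `M₁₁ = P₄^{β₃−β₁}/((β₂−β₁)(β₃−β₁)L′(1,χ))` (surviving form of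
`Z22:§15.u059`, `j = 1`), for the concrete typed residue `Typed.Section15B.calR1 c′ χ 1`.
[cite: Zhang2022LandauSiegel, §15 p. 88] -/
theorem calR1_one_rel : ∃ C : ℝ, 0 ≤ C ∧ ForAllLarge fun D _ χ => AssumptionA D χ →
    ‖calR1 c' χ 1 - ((P4 D : ℝ) : ℂ) ^ (beta3 c' D - beta1 c' D) /
        ((beta2 c' D - beta1 c' D) * (beta3 c' D - beta1 c' D) * deriv χ.LFunction 1)‖ ≤
      C / ell D ^ 6 * ‖((P4 D : ℝ) : ℂ) ^ (beta3 c' D - beta1 c' D) /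
        ((beta2 c' D - beta1 c' D) * (beta3 c' D - beta1 c' D) * deriv χ.LFunction 1)‖ := by
  obtain ⟨K, hK, CL, hCL0, c, hc, D₀, hall⟩ := residue_setup c'
  refine ⟨4 * CL + 12 * (16 * K * π) + 32, by positivity, D₀, fun D _ χ hD hq hp hA => ?_⟩
  obtain ⟨⟨hL, he, hKℓ, hχ1⟩, hcL, hζ, hLb⟩ := hall D χ hD hq hp hA
  clear hall
  have hℓ : 0 < ell D := by linarith
  have hℓ1 : 1 ≤ ell D := by linarith
  have hα := alpha_pos hL
  set L1 : ℂ := deriv χ.LFunction 1 with hL1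
  have hN : 0 < ‖L1‖ := lt_of_lt_of_le hc hcL
  have hL0 : L1 ≠ 0 := fun h => by rw [h, norm_zero] at hN; exact lt_irrefl _ hN
  obtain ⟨hβ1l, -, hβ3l⟩ := norm_beta_ge c' hL he
  have hβ1u := norm_beta1_le c' hL he
  obtain ⟨⟨h21l, h21u⟩, ⟨h31l, h31u⟩, -⟩ := norm_beta_sub c' hL he
  have hβ1ne : beta1 c' D ≠ 0 := fun h => by rw [h, norm_zero] at hβ1l; linarith
  have h21ne : beta2 c' D - beta1 c' D ≠ 0 := fun h => by rw [h, norm_zero] at h21l; linarith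
  have h31ne : beta3 c' D - beta1 c' D ≠ 0 := fun h => by rw [h, norm_zero] at h31l; linarith
  have hP := P4_pos hL
  -- the factors
  obtain ⟨-, -, -, tZ1⟩ := zetaFactor_bounds hL hK hKℓ hζ h21ne h21u
  obtain ⟨-, tZu, -, -⟩ := zetaFactor_bounds hL hK hKℓ hζ h21ne h21u
  have hu1 : ‖-beta1 c' D‖ ≤ 8 * alpha D := by rw [norm_neg]; linarith
  obtain ⟨hζne, -, tZ1inv, -⟩ := zetaFactor_bounds hL hK hKℓ hζ (neg_ne_zero.mpr hβ1ne) hu1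
  clear hζ
  have hζne' : riemannZeta (1 - beta1 c' D) ≠ 0 := by rw [sub_eq_add_neg]; exact hζne
  obtain ⟨hLne, hΛ, hΛhalf⟩ := hLb (beta1 c' D) hβ1l (hβ1u.trans (by linarith))
  clear hLb
  have tΛ := norm_inv_sub_one_le hΛ hΛhalf
  have tΛ1 : 2 * (CL / ell D ^ 6) ≤ 1 := by linarith
  have tω : ‖GaussWeight.omega1 (ell D ^ 30) (beta3 c' D - beta1 c' D) - 1‖ ≤ 32 / ell D ^ 30 :=
    norm_omega1_sub_one_le hL h31u
  have tω1 : 32 / ell D ^ 30 ≤ 1 := by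
    rw [div_le_one (pow_pos hℓ 30)]
    have : (3 : ℝ) ^ 30 ≤ ell D ^ 30 := pow_le_pow_left₀ (by norm_num) hL 30
    nlinarith
  -- closed form and identity
  have hval := calR1_one_eq c' χ hχ1 hP h21ne h31ne hβ1ne hζne' hLne
  rw [add_sub_assoc] at hval
  have hid := residue_identity15 (ζu := riemannZeta (1 + (beta2 c' D - beta1 c' D)))
    (P := ((P4 D : ℝ) : ℂ) ^ (beta3 c' D - beta1 c' D))
    (w := GaussWeight.omega1 (ell D ^ 30) (beta3 c' D - beta1 c' D))
    h21ne h31ne hL0 hζne' hLne hβ1ne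
  rw [hval, hid, show (beta2 c' D - beta1 c' D) * (beta3 c' D - beta1 c' D) * L1 =
    (beta2 c' D - beta1 c' D) * (beta3 c' D - beta1 c' D) * L1 from rfl]
  refine norm_mul_sub_one_le_rel ?_
  -- the product of the four near-one factors, in the order `((Zu · Z₁⁻¹) · Λ⁻¹) · ω`
  have s1 := norm_mul_sub_one_le tZu (by rw [sub_eq_add_neg]; exact tZ1inv) tZ1
  have s2 := norm_mul_sub_one_le s1 tΛ tΛ1
  have s3 := norm_mul_sub_one_le s2 tω tω1
  refine s3.trans ?_
  have p6 : (0 : ℝ) < ell D ^ 6 := pow_pos hℓ 6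
  have i4 : 16 * K * π / ell D ^ 9 ≤ 16 * K * π / ell D ^ 6 :=
    div_le_div_of_nonneg_left (by positivity) p6 (pow_le_pow_right₀ hℓ1 (by norm_num))
  have i5 : 32 / ell D ^ 30 ≤ 32 / ell D ^ 6 :=
    div_le_div_of_nonneg_left (by positivity) p6 (pow_le_pow_right₀ hℓ1 (by norm_num))
  have eq : (4 * CL + 12 * (16 * K * π) + 32) / ell D ^ 6 =
      2 * (2 * (CL / ell D ^ 6)) + 12 * (16 * K * π / ell D ^ 6) + 32 / ell D ^ 6 := by
    field_simp
    ring
  rw [eq]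
  linarith only [i4, i5, hCL0, hK, Real.pi_pos]

/-- **`ℛ₁₂ = M₁₂(1 + O(𝓛⁻⁶))`**, `M₁₂ = P₄^{β₃−β₂}/((β₃−β₂)(β₁−β₂)L′(1,χ))` (surviving form of
`Z22:§15.u059`, `j = 2`; denominator ordered as in the typed node, `(β_{j+1}−βⱼ)(β_{j+2}−βⱼ)`).
[cite: Zhang2022LandauSiegel, §15 p. 88] -/
theorem calR1_two_rel : ∃ C : ℝ, 0 ≤ C ∧ ForAllLarge fun D _ χ => AssumptionA D χ →
    ‖calR1 c' χ 2 - ((P4 D : ℝ) : ℂ) ^ (beta3 c' D - beta2 c' D) /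
        ((beta3 c' D - beta2 c' D) * (beta1 c' D - beta2 c' D) * deriv χ.LFunction 1)‖ ≤
      C / ell D ^ 6 * ‖((P4 D : ℝ) : ℂ) ^ (beta3 c' D - beta2 c' D) /
        ((beta3 c' D - beta2 c' D) * (beta1 c' D - beta2 c' D) * deriv χ.LFunction 1)‖ := by
  obtain ⟨K, hK, CL, hCL0, c, hc, D₀, hall⟩ := residue_setup c'
  refine ⟨4 * CL + 12 * (16 * K * π) + 32, by positivity, D₀, fun D _ χ hD hq hp hA => ?_⟩
  obtain ⟨⟨hL, he, hKℓ, hχ1⟩, hcL, hζ, hLb⟩ := hall D χ hD hq hp hA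
  clear hall
  have hℓ : 0 < ell D := by linarith
  have hℓ1 : 1 ≤ ell D := by linarith
  have hα := alpha_pos hL
  set L1 : ℂ := deriv χ.LFunction 1 with hL1
  have hN : 0 < ‖L1‖ := lt_of_lt_of_le hc hcL
  have hL0 : L1 ≠ 0 := fun h => by rw [h, norm_zero] at hN; exact lt_irrefl _ hN
  obtain ⟨-, hβ2l, -⟩ := norm_beta_ge c' hL he
  have hβ2u := norm_beta2_le c' hL he
  obtain ⟨⟨h21l, h21u⟩, -, ⟨h32l, h32u⟩⟩ := norm_beta_sub c' hL he
  have hβ2ne : beta2 c' D ≠ 0 := fun h => by rw [h, norm_zero] at hβ2l; linarith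
  have h12ne : beta1 c' D - beta2 c' D ≠ 0 := by
    intro h; apply (fun h' => by rw [h', norm_zero] at h21l; linarith : beta2 c' D - beta1 c' D ≠ 0)
    linear_combination -h
  have h12u : ‖beta1 c' D - beta2 c' D‖ ≤ 8 * alpha D := by rw [norm_sub_rev]; exact h21u
  have h32ne : beta3 c' D - beta2 c' D ≠ 0 := fun h => by rw [h, norm_zero] at h32l; linarith
  have hP := P4_pos hL
  obtain ⟨-, tZu, -, tZ1⟩ := zetaFactor_bounds hL hK hKℓ hζ h12ne h12u
  have hu2 : ‖-beta2 c' D‖ ≤ 8 * alpha D := by rw [norm_neg]; linarith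
  obtain ⟨hζne, -, tZ2inv, -⟩ := zetaFactor_bounds hL hK hKℓ hζ (neg_ne_zero.mpr hβ2ne) hu2
  clear hζ
  have hζne' : riemannZeta (1 - beta2 c' D) ≠ 0 := by rw [sub_eq_add_neg]; exact hζne
  obtain ⟨hLne, hΛ, hΛhalf⟩ := hLb (beta2 c' D) hβ2l hβ2u
  clear hLb
  have tΛ := norm_inv_sub_one_le hΛ hΛhalf
  have tΛ1 : 2 * (CL / ell D ^ 6) ≤ 1 := by linarith
  have tω : ‖GaussWeight.omega1 (ell D ^ 30) (beta3 c' D - beta2 c' D) - 1‖ ≤ 32 / ell D ^ 30 :=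
    norm_omega1_sub_one_le hL h32u
  have tω1 : 32 / ell D ^ 30 ≤ 1 := by
    rw [div_le_one (pow_pos hℓ 30)]
    have : (3 : ℝ) ^ 30 ≤ ell D ^ 30 := pow_le_pow_left₀ (by norm_num) hL 30
    nlinarith
  have hval := calR1_two_eq c' χ hχ1 hP h12ne h32ne hβ2ne hζne' hLne
  rw [add_sub_assoc] at hval
  -- reorder the printed denominator `(β₃−β₂)(β₁−β₂)` as `u·d = (β₁−β₂)(β₃−β₂)`
  have hden : (beta3 c' D - beta2 c' D) * (beta1 c' D - beta2 c' D) * L1 =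
      (beta1 c' D - beta2 c' D) * (beta3 c' D - beta2 c' D) * L1 := by ring
  have hid := residue_identity15 (ζu := riemannZeta (1 + (beta1 c' D - beta2 c' D)))
    (P := ((P4 D : ℝ) : ℂ) ^ (beta3 c' D - beta2 c' D))
    (w := GaussWeight.omega1 (ell D ^ 30) (beta3 c' D - beta2 c' D))
    h12ne h32ne hL0 hζne' hLne hβ2ne
  rw [hval, hden, hid]
  refine norm_mul_sub_one_le_rel ?_
  have s1 := norm_mul_sub_one_le tZu (by rw [sub_eq_add_neg]; exact tZ2inv) tZ1
  have s2 := norm_mul_sub_one_le s1 tΛ tΛ1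
  have s3 := norm_mul_sub_one_le s2 tω tω1
  refine s3.trans ?_
  have p6 : (0 : ℝ) < ell D ^ 6 := pow_pos hℓ 6
  have i4 : 16 * K * π / ell D ^ 9 ≤ 16 * K * π / ell D ^ 6 :=
    div_le_div_of_nonneg_left (by positivity) p6 (pow_le_pow_right₀ hℓ1 (by norm_num))
  have i5 : 32 / ell D ^ 30 ≤ 32 / ell D ^ 6 :=
    div_le_div_of_nonneg_left (by positivity) p6 (pow_le_pow_right₀ hℓ1 (by norm_num))
  have eq : (4 * CL + 12 * (16 * K * π) + 32) / ell D ^ 6 =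
      2 * (2 * (CL / ell D ^ 6)) + 12 * (16 * K * π / ell D ^ 6) + 32 / ell D ^ 6 := by
    field_simp
    ring
  rw [eq]
  linarith only [i4, i5, hCL0, hK, Real.pi_pos]

/-- **`ℛ₁₃ = M₁₃(1 + O(𝓛⁻⁶))`**, `M₁₃ = P₄^{β₃−β₃}/((β₁−β₃)(β₂−β₃)L′(1,χ))` (surviving form of
`Z22:§15.u059`, `j = 3`; the pole comes from `1/(s+β₃)`, two `ζ`-factors in the numerator).
[cite: Zhang2022LandauSiegel, §15 p. 88] -/
theorem calR1_three_rel : ∃ C : ℝ, 0 ≤ C ∧ ForAllLarge fun D _ χ => AssumptionA D χ →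
    ‖calR1 c' χ 3 - ((P4 D : ℝ) : ℂ) ^ (beta3 c' D - beta3 c' D) /
        ((beta1 c' D - beta3 c' D) * (beta2 c' D - beta3 c' D) * deriv χ.LFunction 1)‖ ≤
      C / ell D ^ 6 * ‖((P4 D : ℝ) : ℂ) ^ (beta3 c' D - beta3 c' D) /
        ((beta1 c' D - beta3 c' D) * (beta2 c' D - beta3 c' D) * deriv χ.LFunction 1)‖ := by
  obtain ⟨K, hK, CL, hCL0, c, hc, D₀, hall⟩ := residue_setup c'
  refine ⟨4 * CL + 28 * (16 * K * π) + 32, by positivity, D₀, fun D _ χ hD hq hp hA => ?_⟩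
  obtain ⟨⟨hL, he, hKℓ, hχ1⟩, hcL, hζ, hLb⟩ := hall D χ hD hq hp hA
  clear hall
  have hℓ : 0 < ell D := by linarith
  have hℓ1 : 1 ≤ ell D := by linarith
  have hα := alpha_pos hL
  set L1 : ℂ := deriv χ.LFunction 1 with hL1
  have hN : 0 < ‖L1‖ := lt_of_lt_of_le hc hcL
  have hL0 : L1 ≠ 0 := fun h => by rw [h, norm_zero] at hN; exact lt_irrefl _ hN
  obtain ⟨-, -, hβ3l⟩ := norm_beta_ge c' hL he
  have hβ3u := norm_beta3_le c' hL he
  obtain ⟨-, ⟨h31l, h31u⟩, ⟨h32l, h32u⟩⟩ := norm_beta_sub c' hL he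
  have hβ3ne : beta3 c' D ≠ 0 := fun h => by rw [h, norm_zero] at hβ3l; linarith
  have h13ne : beta1 c' D - beta3 c' D ≠ 0 := by
    intro h; apply (fun h' => by rw [h', norm_zero] at h31l; linarith : beta3 c' D - beta1 c' D ≠ 0)
    linear_combination -h
  have h23ne : beta2 c' D - beta3 c' D ≠ 0 := by
    intro h; apply (fun h' => by rw [h', norm_zero] at h32l; linarith : beta3 c' D - beta2 c' D ≠ 0)
    linear_combination -h
  have h13u : ‖beta1 c' D - beta3 c' D‖ ≤ 8 * alpha D := by rw [norm_sub_rev]; exact h31u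
  have h23u : ‖beta2 c' D - beta3 c' D‖ ≤ 8 * alpha D := by rw [norm_sub_rev]; exact h32u
  have hP := P4_pos hL
  obtain ⟨-, tZu1, -, tZ1⟩ := zetaFactor_bounds hL hK hKℓ hζ h13ne h13u
  obtain ⟨-, tZu2, -, -⟩ := zetaFactor_bounds hL hK hKℓ hζ h23ne h23u
  have hu3 : ‖-beta3 c' D‖ ≤ 8 * alpha D := by rw [norm_neg]; linarith
  obtain ⟨hζne, -, tZ3inv, -⟩ := zetaFactor_bounds hL hK hKℓ hζ (neg_ne_zero.mpr hβ3ne) hu3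
  clear hζ
  have hζne' : riemannZeta (1 - beta3 c' D) ≠ 0 := by rw [sub_eq_add_neg]; exact hζne
  obtain ⟨hLne, hΛ, hΛhalf⟩ := hLb (beta3 c' D) hβ3l hβ3u
  clear hLb
  have tΛ := norm_inv_sub_one_le hΛ hΛhalf
  have tΛ1 : 2 * (CL / ell D ^ 6) ≤ 1 := by linarith
  have h33u : ‖beta3 c' D - beta3 c' D‖ ≤ 8 * alpha D := by rw [sub_self, norm_zero]; positivity
  have tω : ‖GaussWeight.omega1 (ell D ^ 30) (beta3 c' D - beta3 c' D) - 1‖ ≤ 32 / ell D ^ 30 :=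
    norm_omega1_sub_one_le hL h33u
  have tω1 : 32 / ell D ^ 30 ≤ 1 := by
    rw [div_le_one (pow_pos hℓ 30)]
    have : (3 : ℝ) ^ 30 ≤ ell D ^ 30 := pow_le_pow_left₀ (by norm_num) hL 30
    nlinarith
  have hval := calR1_three_eq c' χ hχ1 hP h13ne h23ne hβ3ne hζne' hLne
  rw [add_sub_assoc, add_sub_assoc] at hval
  have hid := residue_identity15_three (ζ₁ := riemannZeta (1 + (beta1 c' D - beta3 c' D)))
    (ζ₂ := riemannZeta (1 + (beta2 c' D - beta3 c' D)))
    (P := ((P4 D : ℝ) : ℂ) ^ (beta3 c' D - beta3 c' D))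
    (w := GaussWeight.omega1 (ell D ^ 30) (beta3 c' D - beta3 c' D))
    h13ne h23ne hL0 hζne' hLne hβ3ne
  rw [hval, hid]
  refine norm_mul_sub_one_le_rel ?_
  have s1 := norm_mul_sub_one_le tZu1 tZu2 tZ1
  have s2 := norm_mul_sub_one_le s1 (by rw [sub_eq_add_neg]; exact tZ3inv) tZ1
  have s3 := norm_mul_sub_one_le s2 tΛ tΛ1
  have s4 := norm_mul_sub_one_le s3 tω tω1
  refine s4.trans ?_
  have p6 : (0 : ℝ) < ell D ^ 6 := pow_pos hℓ 6
  have i4 : 16 * K * π / ell D ^ 9 ≤ 16 * K * π / ell D ^ 6 :=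
    div_le_div_of_nonneg_left (by positivity) p6 (pow_le_pow_right₀ hℓ1 (by norm_num))
  have i5 : 32 / ell D ^ 30 ≤ 32 / ell D ^ 6 :=
    div_le_div_of_nonneg_left (by positivity) p6 (pow_le_pow_right₀ hℓ1 (by norm_num))
  have i6 : CL / ell D ^ 6 ≤ CL / ell D ^ 6 := le_rfl
  have eq : (4 * CL + 28 * (16 * K * π) + 32) / ell D ^ 6 =
      2 * (2 * (CL / ell D ^ 6)) + 28 * (16 * K * π / ell D ^ 6) + 32 / ell D ^ 6 := by
    field_simp
    ring
  rw [eq]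
  linarith only [i4, i5, hCL0, hK, Real.pi_pos]

end Literature.NumberTheory.LFunctions.Zhang2022.ResidueValues
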